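import Summits.ResolutionOfSingularities.ResolutionOfSingularities.Theorems.PurelyInseparableDim4PhiLineLoseLawChild
import Summits.ResolutionOfSingularities.ResolutionOfSingularities.Theorems.PurelyInseparableDim4PhiLinePolygon
import HarnessLib

/-!
# (K-Φ2) XV: the Φ-line one-step laws for a SUPERCRITICAL boundary letter (`r_h + n = p`, `n ≤ d`) — the two threshold lemmas
# and the KEEP / LOSE laws with a cleaning term in `(u₁^n)` (cell `res-dim4-pi`, slice C; inputs of the «heavy line» I-1-9)

[OURS · counted 0 · cell `res-dim4-pi` · seat res-dim4-p-11 g5 (Φ-line lineage).]  Nothing here proves TAIL-D, K2(5)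
(`RidgeBudget.NoAboveFloorTrap 5 5`) or resolution of singularities in dimension ≥ 4 / characteristic `p` — NOT proved.  AI kernel
work, weaker than expert review.

The tree's one-step laws of the β_h line ((K-Φ2) IV `betaS_step_lt_of_keep` / `betaS_step_le_of_lose`, XII
`betaS_step_le_of_lose_of_child`) are stated for a CRITICAL letter `h` (`r_h + d = p`): then the cleaning correction `R̃` of the next
residual `G′ = ε·H₀ + R̃` lies in `(x_h^d) = (u₁^d)`, and (K-Φ3) V (`pts_nonempty_and_alphaS_betaS_eq_of_cleaning`, threshold `αs < d!`,
i.e. `α < 1`) says cleaning does not move the vertex `v = (α, β)`.  An audit of those proofs (bus 2026-08-29 07:14Z/07:18Z) shows that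
`hcrit`/`hcrit′` enter ONLY through this exponent.  For a SUPERCRITICAL letter (`r_h + n = p` with `n ≤ d`, e.g. the heavy letter of
res-dim4-idea-1's CARDS I-1-9/I-1-10: `(p, d, r_h, n) = (5, 4, 2, 3)`) the correction lies in `(u₁^n)` only; the vertex argument goes
through under a sharper threshold, but the UNCLEANED weak transform `H₀` may now have order `< d` at a point that is near for the
cleaned residual («order-raising cleaning»; res-dim4-crit-2 V-B-66: 2 of 167 in-class D∞ edges), so the cleaning transfer is run from the
CHILD side, on `(G′) ⊆ 𝔪^d`, and never assumes `ord₀ H₀ ≥ d`: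

* §1 **(T1) `pts_nonempty_and_alphaS_betaS_eq_of_cleaning_pow`** — cleaning-blindness with `ρ ∈ (u₁^n)` under `μ·(αs + 1) ≤ n·μ!`
  (`u₁^n` lies strictly above every steep line of slope `N > βs` through `v`); `n = μ` is (K-Φ3) V's `αs < μ!`; `(μ, n) = (4, 3)` reads
  `α < 3/4`.  Child-side form **`…_cleaning_pow_symm`**: hypotheses on the PERTURBED ideal `(ε g + ρ)` only.
* §2 **(T2) `mul_alphaS_le_of_not_le_yu1_pow`** — polygon reading `¬ J ≤ (y, u₁)^n`, `n ≤ μ` ⇒ Newton points exist and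
  `μ·αs ≤ (n − 1)·μ!` (CJS Lemma 11.5's weight `(K, …, K, K, 1)` at level `K·n`); `(μ, n) = (4, 3)` reads `α ≤ 1/2`; and its
  (K-Φ1) instance **`mul_alphaS_le_of_isIsolated`**: an isolated `F = x^r·G` with `p ≤ r_h + n`, `n ≤ d`, in every r.s.p.
  `c = (y₁, y₂, u₁, u₂)` of `𝒪` with `u₁ = x_h`: `d·αs((G)) ≤ (n − 1)·d!`.
* §3 **`betaS_step_lt_of_keep_pow`** — IV KEEP with `hcrit` replaced by `r h + n = p`, `0 < n ≤ d`, and the cleaning transfer from the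
  child's polygon data (`pts ≠ ∅`, `d(αs′ + 1) ≤ n·d!` in the arrival frame).
* §4 **`betaS_step_le_of_lose_of_child_pow`** — XII LOSE (child side) with `hcrit′` replaced by `r′_h + n ≤ p` and the child's `hα′`
  by `d(αs′ + 1) ≤ n·d!`.
(Independent second typing of §1–§2: res-dim4-p-7 g5 `…PhiLineHeavyThresholds`, HOME-only, withdrawn in favour of this file.)

[cite: CossartJannsenSaito2020, Lemma 8.3 (4), Lemma 11.5, Lemma 12.1 (3), Lemma 12.2 (5), Lemma 13.4 (3)] [cite: CossartPiltant2008, (16),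
Lemma 4.5 (2), §4 p. 10] [cite: Hauser2010, §§F–G]  bears_on: LADDER-RESOLUTION:D157-DOOR2 (res-dim4-pi · slice C · Φ-line
supercritical letter).  Supports stmt-ResolutionOfSingularities-16155 (helper).
-/

set_option linter.dupNamespace false -- mandated namespace of this single-conjunct summit

noncomputable section

namespace Summit.ResolutionOfSingularities.ResolutionOfSingularities.Theorems.PIDim4

namespace PhiLine

open MvPolynomial Finset IsLocalRing
open Literature.AlgebraicGeometry.Resolution
open Literature.AlgebraicGeometry.Resolution.Hauser2010
open Literature.AlgebraicGeometry.Resolution.WeightedOrder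

universe u

/-! ## §1 (T1) Cleaning-blindness with a correction in `(u₁^n)` -/

section Steep

variable {R : Type u} [CommRing R] [IsRegularLocalRing R] {r : ℕ} (c : Fin (r + 2) → R)
  (hgen : Ideal.span (Set.range c) = maximalIdeal R) (hdim : ringKrullDim R = r + 2) {μ : ℕ}

omit [IsRegularLocalRing R] in
/-- `u₁^n` lies strictly above every steep line of slope `N > βs` through `v` once `μ·(αs + 1) ≤ n·μ!`: its weight `n·μ!·N` exceeds the
level `(Nαs + βs)·μ`. [cite: CossartJannsenSaito2020, Def. 11.1] -/
theorem pow_u1_mem_weightedOrderIdeal_steep_succ_of_le (hμ : 0 < μ) {n αs βs N : ℕ} (hα : μ * (αs + 1) ≤ n * μ.factorial)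
    (hN : βs < N) :
    c (u1 r) ^ n ∈ weightedOrderIdeal c (levelWeight μ (N * αs + βs) N 1) ((N * αs + βs) * μ + 1) := by
  have h := weightedOrderIdeal_pow_le c (levelWeight μ (N * αs + βs) N 1) _ n
    (Ideal.pow_mem_pow (apply_mem_weightedOrderIdeal c (levelWeight μ (N * αs + βs) N 1) (u1 r)) n)
  refine weightedOrderIdeal_antitone c _ ?_ h
  rw [levelWeight_u1]
  have h1 : μ * (αs + 1) * N ≤ n * μ.factorial * N := Nat.mul_le_mul_right N hα
  have h3 : μ * (βs + 1) ≤ μ * N := Nat.mul_le_mul_left μ hN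
  have h2 : (N * αs + βs) * μ + 1 ≤ μ * (αs + 1) * N := by nlinarith [h3, hμ]
  calc (N * αs + βs) * μ + 1 ≤ μ * (αs + 1) * N := h2
    _ ≤ n * μ.factorial * N := h1
    _ = n * (μ.factorial * N) := by ring

include hgen hdim in
/-- **(T1) Cleaning in `(u₁^n)` and units do not move `v` when `μ·(αs + 1) ≤ n·μ!`.**  For `J = (g) ⊆ 𝔪^μ` with non-empty polygon:
if `ε` is a unit and `ρ ∈ (u₁^n)` with `μ·(αs + 1) ≤ n·μ!`, then `(ε g + ρ)` has a non-empty polygon with the same `αs`, `βs`.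
(`n = μ`: (K-Φ3) V, `α < 1`; `(μ, n) = (4, 3)`: `α < 3/4`.) [cite: CossartJannsenSaito2020, Lemma 8.3 (4)] [cite: CossartPiltant2008, §4 p. 10] -/
theorem pts_nonempty_and_alphaS_betaS_eq_of_cleaning_pow {g ρ ε : R} {n : ℕ} (hε : IsUnit ε)
    (hJμ : Ideal.span {g} ≤ maximalIdeal R ^ μ) (hne : (pts c (Ideal.span {g}) μ).Nonempty)
    (hα : μ * (alphaS c (Ideal.span {g}) μ + 1) ≤ n * μ.factorial) (hρ : ρ ∈ Ideal.span {c (u1 r) ^ n}) :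
    (pts c (Ideal.span {ε * g + ρ}) μ).Nonempty ∧ alphaS c (Ideal.span {ε * g + ρ}) μ = alphaS c (Ideal.span {g}) μ ∧
      betaS c (Ideal.span {ε * g + ρ}) μ = betaS c (Ideal.span {g}) μ := by
  have hμ : 0 < μ := by obtain ⟨e, he⟩ := hne; have := he.2; omega
  refine pts_nonempty_and_alphaS_betaS_eq_of_generator_perturb c hgen hdim hε hJμ hne (N₀ := betaS c (Ideal.span {g}) μ + 1)
    (Nat.lt_succ_self _) fun N hN => ?_
  obtain ⟨a, rfl⟩ := Ideal.mem_span_singleton'.mp hρ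
  exact Ideal.mul_mem_left _ _ (pow_u1_mem_weightedOrderIdeal_steep_succ_of_le c hμ hα (by omega))

include hgen hdim in
/-- **(T1, child side)**: if `ε` is a unit, `ρ ∈ (u₁^n)`, and the PERTURBED generator `ε g + ρ` spans an ideal `⊆ 𝔪^μ` with
non-empty polygon and `μ·(αs + 1) ≤ n·μ!`, then `(g)` has non-empty polygon and the same `αs`, `βs` ((T1) applied to
`g = ε⁻¹(ε g + ρ) + (−ε⁻¹ρ)`).  No hypothesis on `(g)` itself: on the chain `g` is the UNCLEANED weak transform `H₀`, whose order may
be `< μ` at a supercritical letter, while `ε g + ρ = G′` is the cleaned residual of order `μ`.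
[cite: CossartJannsenSaito2020, Lemma 12.2 (1)] [cite: CossartPiltant2008, Lemma 4.5 (2)] -/
theorem pts_nonempty_and_alphaS_betaS_eq_of_cleaning_pow_symm {g ρ ε : R} {n : ℕ} (hε : IsUnit ε)
    (hJμ : Ideal.span {ε * g + ρ} ≤ maximalIdeal R ^ μ) (hne : (pts c (Ideal.span {ε * g + ρ}) μ).Nonempty)
    (hα : μ * (alphaS c (Ideal.span {ε * g + ρ}) μ + 1) ≤ n * μ.factorial) (hρ : ρ ∈ Ideal.span {c (u1 r) ^ n}) :
    (pts c (Ideal.span {g}) μ).Nonempty ∧ alphaS c (Ideal.span {ε * g + ρ}) μ = alphaS c (Ideal.span {g}) μ ∧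
      betaS c (Ideal.span {ε * g + ρ}) μ = betaS c (Ideal.span {g}) μ := by
  obtain ⟨u, rfl⟩ := hε
  have hρ' : -(↑u⁻¹ * ρ) ∈ Ideal.span {c (u1 r) ^ n} := (Ideal.neg_mem_iff _).mpr (Ideal.mul_mem_left _ _ hρ)
  have h := pts_nonempty_and_alphaS_betaS_eq_of_cleaning_pow c hgen hdim (Units.isUnit u⁻¹) hJμ hne hα hρ'
  have hg : ↑u⁻¹ * (↑u * g + ρ) + -(↑u⁻¹ * ρ) = g := by
    rw [mul_add, ← mul_assoc, Units.inv_mul, one_mul, add_neg_cancel_right]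
  rw [hg] at h
  exact ⟨h.1, h.2.1.symm, h.2.2.symm⟩

end Steep

/-! ## §2 (T2) The polygon reading of `J ⊄ (y, u₁)^n`, `n ≤ μ` -/

section Reading

variable {R : Type u} [CommRing R] [IsRegularLocalRing R] {r : ℕ} (c : Fin (r + 2) → R)
  (hgen : Ideal.span (Set.range c) = maximalIdeal R) (hdim : ringKrullDim R = r + 2) {J : Ideal R} {μ : ℕ}

include hgen hdim in
/-- **(T2) `J ⊄ (y, u₁)^n`, `n ≤ μ` ⇒ Newton points exist and `μ·αs ≤ (n − 1)·μ!`** (i.e. `α ≤ (n − 1)/μ`): CJS Lemma 11.5's weight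
`(K, …, K, K, 1)` at level `K·n` exhibits an initial term `e` with `|e|_y + e_{u₁} ≤ n − 1`, whose point has abscissa
`e_{u₁}/(μ − |e|_y) ≤ (n − 1)/μ`.  `n = μ` gives `αs < μ!` (`WeightedOrder.alphaS_lt_of_not_le_yu1_pow`).
[cite: CossartJannsenSaito2020, Lemma 11.5] [cite: CossartPiltant2008, (16)] -/
theorem mul_alphaS_le_of_not_le_yu1_pow {n : ℕ} (hnμ : n ≤ μ) (hJ : ¬ J ≤ yu1Ideal c ^ n) :
    (pts c J μ).Nonempty ∧ μ * alphaS c J μ ≤ (n - 1) * μ.factorial := by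
  classical
  obtain ⟨f, hfJ, hf⟩ := Set.not_subset.mp hJ
  obtain ⟨K₀, hK₀⟩ := exists_not_mem_sup_pow hf
  set K := K₀ + 1 with hK
  have hfK : f ∉ yu1Ideal c ^ n ⊔ maximalIdeal R ^ K := fun h =>
    hK₀ (sup_le_sup_left (Ideal.pow_le_pow_right (by omega : K₀ ≤ K)) (yu1Ideal c ^ n) h)
  have hw : ∀ i, 0 < wK1 r K i := wK1_pos (by omega)
  have hfW : f ∉ weightedOrderIdeal c (wK1 r K) (K * n) := fun h => hfK (weightedOrderIdeal_wK1_le c hgen K n h)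
  rw [mem_weightedOrderIdeal_iff_forall_isInitialTerm c hgen hdim hw] at hfW
  push Not at hfW
  obtain ⟨e, he, hlt⟩ := hfW
  rw [weight_wK1] at hlt
  have h01 : ydeg e + e (u1 r) + 1 ≤ n := by
    by_contra h'
    push Not at h'
    have : K * n ≤ K * (ydeg e + e (u1 r)) := Nat.mul_le_mul_left _ (by omega)
    omega
  have he0 : ydeg e < μ := by omega
  have hpts : e ∈ pts c J μ := ⟨mem_occ_of_isInitialTerm c hfJ hw he, he0⟩
  refine ⟨⟨e, hpts⟩, le_trans (Nat.mul_le_mul_left μ (alphaS_le hpts)) ?_⟩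
  -- `μ · e_{u₁} · sfac ≤ (n − 1) · (μ − |e|_y) · sfac = (n − 1) · μ!`
  rw [WeightedOrder.spt₁, ← sub_mul_sfac he0]
  have hkey : μ * e (u1 r) ≤ (n - 1) * (μ - ydeg e) := by
    -- `e_{u₁} ≤ n − 1 − t` and `μ (n − 1 − t) ≤ (n − 1)(μ − t)` for `t = |e|_y`
    have h1 : μ * e (u1 r) ≤ μ * (n - 1 - ydeg e) := Nat.mul_le_mul_left μ (by omega)
    have h2 : μ * (n - 1 - ydeg e) + μ * ydeg e = (n - 1) * (μ - ydeg e) + (n - 1) * ydeg e := by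
      zify [show ydeg e ≤ μ by omega, show ydeg e ≤ n - 1 by omega, show 1 ≤ n by omega]
      ring
    have h3 : (n - 1) * ydeg e ≤ μ * ydeg e := Nat.mul_le_mul_right _ (by omega)
    omega
  calc μ * (e (u1 r) * sfac μ e) = μ * e (u1 r) * sfac μ e := by ring
    _ ≤ (n - 1) * (μ - ydeg e) * sfac μ e := Nat.mul_le_mul_right _ hkey
    _ = (n - 1) * ((μ - ydeg e) * sfac μ e) := by ring

end Reading

/-! ## §2b (K-Φ1) for a supercritical letter: `d·αs ≤ (n − 1)·d!` in every regular frame with `u₁ = x_h` -/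

variable {K : Type} [Field K]

/-- **(K-Φ1), SUPERCRITICAL POLYGON READING.**  In `𝒪_{𝔸⁴,0} = OriginLocalization K 4`, for ANY regular system of parameters
`c = (y₁, y₂, u₁, u₂)` whose `u₁` is a boundary letter `x_h` of an isolated state `F = x^r·G` with `p ≤ r_h + n` and `n ≤ d`:
Newton points of `(G)` (degree `d`) exist and `d·αs ≤ (n − 1)·d!`, i.e. `α_h ≤ (n − 1)/d` — by (K-Φ1′)
`not_mem_primePow_loc_of_isIsolated` at exponent `n` for `𝔮 = (y₁, y₂, u₁)` and (T2).  (`n = d`: `α < 1`, the tree's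
`alphaS_lt_of_isIsolated`; heavy letter `(p, d, r_h, n) = (5, 4, 2, 3)`: `α ≤ 1/2`.)
[cite: CossartJannsenSaito2020, Lemma 11.5, Lemma 13.4 (3)] [folklore] -/
theorem mul_alphaS_le_of_isIsolated {p d n : ℕ} {F G : MvPolynomial (Fin 4) K} {r : Fin 4 →₀ ℕ}
    (hF : F = monomial r 1 * G) (hiso : IsIsolated p F) {h : Fin 4} (hn : p ≤ r h + n) (hnd : n ≤ d)
    (c : Fin (2 + 2) → OriginLocalization K 4)
    (hgen : Ideal.span (Set.range c) = maximalIdeal (OriginLocalization K 4))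
    (hu1 : c (u1 2) = algebraMap (MvPolynomial (Fin 4) K) (OriginLocalization K 4) (X h)) :
    (pts c (Ideal.span {algebraMap (MvPolynomial (Fin 4) K) (OriginLocalization K 4) G}) d).Nonempty ∧
      d * alphaS c (Ideal.span {algebraMap (MvPolynomial (Fin 4) K) (OriginLocalization K 4) G}) d ≤ (n - 1) * d.factorial := by
  have hdim : ringKrullDim (OriginLocalization K 4) = (2 : ℕ) + 2 := by
    rw [ringKrullDim_originLocalization]
    rfl
  refine mul_alphaS_le_of_not_le_yu1_pow c hgen hdim hnd fun hle => ?_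
  have hh : algebraMap (MvPolynomial (Fin 4) K) (OriginLocalization K 4) (X h) ∈ yu1Ideal c := by
    rw [← hu1]
    exact Ideal.subset_span (Set.mem_insert _ _)
  exact not_mem_primePow_loc_of_isIsolated hF hiso hn (isPrime_yu1Ideal c hgen) (yu1Ideal_ne_maximalIdeal c hgen) hh
    (hle (Ideal.mem_span_singleton_self _))

/-! ## §3 The KEEP step at a supercritical letter (child-side cleaning transfer) -/

/-- **KEEP-h ONE-STEP LAW, SUPERCRITICAL LETTER** ((K-Φ2) IV `betaS_step_lt_of_keep` with `r_h + d = p` replaced by `r_h + n = p`,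
`0 < n ≤ d`, and the cleaning transfer done from the CHILD side).  Let `s.F = x^r · G` with `ord₀ G = d`, `1 ≤ d < p`, `p ≤ |r| + d`,
boundary letter `h` with `r_h + n = p`, chart letter `m ≠ h`, new point `b` with `b_m = b_h = 0`; `L` a left-invertible linear STEP
frame (`u₁ = e_h`, `u₂ = e_m`, non-pivot rows through the new point) with non-empty polygon, `δ > 1`, `α < 1` for `(G)`; `L′` the
ARRIVAL frame.  If the next residual `G′` (`(step p univ m b s).F = x^{r′} · G′`) has `ord₀ G′ ≥ d` AND, in the arrival frame, a
non-empty polygon with `d·(αs′ + 1) ≤ n·d!` (on the chain: (K-Φ1)-n `mul_alphaS_le_of_isIsolated` at the isolated child), then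
`αs′ = αs` and **`βs′ < βs`**.  The cleaning correction `R̃ ∈ (x_h^{p − r_h}) = (x_h^n)` is moved by (T1) applied to `G′`, so no
hypothesis on the order of the uncleaned weak transform is needed. [cite: CossartJannsenSaito2020, Lemma 13.4 (3)] [cite: CossartPiltant2008, (16)] -/
theorem betaS_step_lt_of_keep_pow {p d n : ℕ} [DecidableEq K] {s : State K} {r : Fin 4 →₀ ℕ} {G : MvPolynomial (Fin 4) K}
    (hF : s.F = monomial r 1 * G) (hd : ordZero G = d) (hdp : d < p) (hp : p ≤ r.degree + d)
    {h m : Fin 4} (hhm : h ≠ m) (hn : r h + n = p) (hn0 : 0 < n) (hnd : n ≤ d) {b : Fin 4 → K} (hbm : b m = 0) (hbh : b h = 0)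
    (L L' : Fin (2 + 2) → Fin 4 → K) (M M' : Fin 4 → Fin (2 + 2) → K)
    (hM : ∀ t u, ∑ i, M t i * L i u = if t = u then 1 else 0) (hM' : ∀ t u, ∑ i, M' t i * L' i u = if t = u then 1 else 0)
    (hLu1 : L (u1 2) = Pi.single h 1) (hLu2 : L (u2 2) = Pi.single m 1)
    (hnear : ∀ i, i ≠ u2 2 → ∑ t, L i t * Function.update b m 1 t = 0)
    (hL'u2 : L' (u2 2) = Pi.single m 1) (hL' : ∀ i, i ≠ u2 2 → L' i = Function.update (L i) m 0)
    (hne : (pts (fun i => algebraMap (MvPolynomial (Fin 4) K) (OriginLocalization K 4) (∑ t, C (L i t) * X t))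
      (Ideal.span {algebraMap (MvPolynomial (Fin 4) K) (OriginLocalization K 4) G}) d).Nonempty)
    (hδ : d.factorial < deltaS (fun i => algebraMap (MvPolynomial (Fin 4) K) (OriginLocalization K 4) (∑ t, C (L i t) * X t))
      (Ideal.span {algebraMap (MvPolynomial (Fin 4) K) (OriginLocalization K 4) G}) d)
    (hα : alphaS (fun i => algebraMap (MvPolynomial (Fin 4) K) (OriginLocalization K 4) (∑ t, C (L i t) * X t))
      (Ideal.span {algebraMap (MvPolynomial (Fin 4) K) (OriginLocalization K 4) G}) d < d.factorial)
    {G' : MvPolynomial (Fin 4) K}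
    (hF' : (CentreBlowup.step p Finset.univ m b s).F = monomial ((r.filter fun i => b i = 0).update m (r.degree + d - p)) 1 * G')
    (hd' : (d : ℕ∞) ≤ ordZero G')
    (hne' : (pts (fun i => algebraMap (MvPolynomial (Fin 4) K) (OriginLocalization K 4) (∑ t, C (L' i t) * X t))
      (Ideal.span {algebraMap (MvPolynomial (Fin 4) K) (OriginLocalization K 4) G'}) d).Nonempty)
    (hα' : d * (alphaS (fun i => algebraMap (MvPolynomial (Fin 4) K) (OriginLocalization K 4) (∑ t, C (L' i t) * X t))
      (Ideal.span {algebraMap (MvPolynomial (Fin 4) K) (OriginLocalization K 4) G'}) d + 1) ≤ n * d.factorial) :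
    (pts (fun i => algebraMap (MvPolynomial (Fin 4) K) (OriginLocalization K 4) (∑ t, C (L' i t) * X t))
        (Ideal.span {algebraMap (MvPolynomial (Fin 4) K) (OriginLocalization K 4) G'}) d).Nonempty ∧
      alphaS (fun i => algebraMap (MvPolynomial (Fin 4) K) (OriginLocalization K 4) (∑ t, C (L' i t) * X t))
          (Ideal.span {algebraMap (MvPolynomial (Fin 4) K) (OriginLocalization K 4) G'}) d =
        alphaS (fun i => algebraMap (MvPolynomial (Fin 4) K) (OriginLocalization K 4) (∑ t, C (L i t) * X t))
          (Ideal.span {algebraMap (MvPolynomial (Fin 4) K) (OriginLocalization K 4) G}) d ∧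
      betaS (fun i => algebraMap (MvPolynomial (Fin 4) K) (OriginLocalization K 4) (∑ t, C (L' i t) * X t))
          (Ideal.span {algebraMap (MvPolynomial (Fin 4) K) (OriginLocalization K 4) G'}) d <
        betaS (fun i => algebraMap (MvPolynomial (Fin 4) K) (OriginLocalization K 4) (∑ t, C (L i t) * X t))
          (Ideal.span {algebraMap (MvPolynomial (Fin 4) K) (OriginLocalization K 4) G}) d := by
  -- abbreviations
  set alg := algebraMap (MvPolynomial (Fin 4) K) (OriginLocalization K 4) with halg
  set c : Fin (2 + 2) → OriginLocalization K 4 := fun i => alg (∑ t, C (L i t) * X t) with hc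
  set c' : Fin (2 + 2) → OriginLocalization K 4 := fun i => alg (∑ t, C (L' i t) * X t) with hc'
  set J : Ideal (OriginLocalization K 4) := Ideal.span {alg G} with hJ
  set φ := Localization.localRingHom (Literature.AlgebraicGeometry.Resolution.originIdeal K 4)
      (Literature.AlgebraicGeometry.Resolution.originIdeal K 4)
      (((aeval fun i => (X i + C (b i) : MvPolynomial (Fin 4) K)).comp
        (coordBlowupSubst K (↑(Finset.univ : Finset (Fin 4))) m)).toRingHom)
      (comap_translate_coordBlowupSubst_originIdeal hbm) with hφ
  have hdG : (d : ℕ∞) ≤ ordZero G := hd.symm.le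
  -- the frames
  have hcu2 : c (u2 2) = alg (X m) := by simp only [hc, hLu2, sum_C_single_mul_X]
  have hc'u2 : c' (u2 2) = alg (X m) := by simp only [hc', hL'u2, sum_C_single_mul_X]
  have hc'u1 : c' (u1 2) = alg (X h) := by
    simp only [hc', hL' (u1 2) u1_ne_u2, hLu1, update_single_of_ne hhm, sum_C_single_mul_X]
  have hpiv : c' (u2 2) = φ (c (u2 2)) := by rw [hc'u2, hcu2, hφ, localRingHom_chart_X_self hbm]
  have hoth : ∀ i, i ≠ u2 2 → φ (c i) = φ (c (u2 2)) * c' i := by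
    intro i hi
    rw [hcu2, hφ, localRingHom_chart_X_self hbm]
    change Localization.localRingHom _ _ _ _ (alg (∑ t, C (L i t) * X t)) = alg (X m) * alg (∑ t, C (L' i t) * X t)
    rw [hL' i hi, halg, localRingHom_chart_linearForm hbm (L i) (hnear i hi)]
  have hgen : Ideal.span (Set.range c) = maximalIdeal _ := span_range_linearFrame_eq_maximalIdeal L M hM
  have hgen' : Ideal.span (Set.range c') = maximalIdeal _ := span_range_linearFrame_eq_maximalIdeal L' M' hM'
  have hdim := ringKrullDim_originLocalization_two_add_two (K := K)
  have hJμ : J ≤ maximalIdeal _ ^ d := span_singleton_algebraMap_le_maximalIdeal_pow hdG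
  -- the abstract KEEP law (about the colon ideal, whatever its order)
  have hlaw := betaS_colon_u2_lt φ hpiv hoth hgen hdim hgen' hdim hJμ hne hδ hα
  have hαlaw := alphaS_colon_u2_eq φ hpiv hoth hgen hdim hgen' hdim hJμ hne hδ
  -- the weak transform is `(H₀)`
  have hcolon : (J.map φ).colon {φ (c (u2 2)) ^ d} =
      Ideal.span {alg (PointBlowup.translate b (CentreBlowup.chartTransform d Finset.univ m G))} := by
    rw [hcu2, hφ, localRingHom_chart_X_self hbm, hJ, halg]
    exact colon_map_span_singleton_chart hbm G hdG
  rw [hcolon] at hlaw hαlaw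
  -- the next residual `G′ = ε H₀ + R̃`, `R̃ ∈ (x_h^n)`
  obtain ⟨R, hstep, hRmem⟩ := step_F_eq_monomial_mul_residual (p := p) hF hdG hp m hbm
  rw [hF', monomial_one_mul_cancel_left_iff] at hstep
  have hr'h : ((r.filter fun i => b i = 0).update m (r.degree + d - p)) h = p - n := by
    rw [Finsupp.coe_update, Function.update_of_ne hhm, Finsupp.filter_apply_pos (fun i => b i = 0) r hbh]; omega
  have hndvd : ¬ p ∣ ((r.filter fun i => b i = 0).update m (r.degree + d - p)) h := by
    rw [hr'h]
    intro hdvd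
    exact absurd (Nat.le_of_dvd (by omega) hdvd) (by omega)
  have hR : R ∈ Ideal.span {(X h : MvPolynomial (Fin 4) K) ^ n} := by
    have := hRmem h hndvd
    rwa [hr'h, show p - (p - n) = n by omega] at this
  -- (T1) from the child side: `(G′) ⊆ 𝔪^d`, the child's polygon data, `alg R̃ ∈ (u₁′^n)`
  have hε := constantCoeff_prod_ne_zero b (fun i => r i)
  have hG' : Ideal.span {alg G'} = Ideal.span {alg (∏ i ∈ Finset.univ.filter (fun i => b i ≠ 0), (X i + C (b i)) ^ r i) *
      alg (PointBlowup.translate b (CentreBlowup.chartTransform d Finset.univ m G)) + alg R} := by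
    rw [hstep, map_add, map_mul]
  rw [hG'] at hne' hα' ⊢
  have hJμ' : Ideal.span {alg (∏ i ∈ Finset.univ.filter (fun i => b i ≠ 0), (X i + C (b i)) ^ r i) *
      alg (PointBlowup.translate b (CentreBlowup.chartTransform d Finset.univ m G)) + alg R} ≤ maximalIdeal _ ^ d := by
    rw [← hG']
    exact span_singleton_algebraMap_le_maximalIdeal_pow hd'
  have hclean := pts_nonempty_and_alphaS_betaS_eq_of_cleaning_pow_symm c' hgen' hdim
    (isUnit_algebraMap_of_constantCoeff_ne_zero hε) hJμ' hne' hα'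
    (by rw [hc'u1]; exact algebraMap_mem_span_pow_of_mem_span_pow le_rfl hR)
  exact ⟨hne', hclean.2.1.trans hαlaw, hclean.2.2.trans_lt hlaw⟩

/-! ## §4 The LOSE step at a supercritical newborn letter (child side) -/

/-- **LOSE-h ONE-STEP LAW, SUPERCRITICAL NEWBORN LETTER, child side** ((K-Φ2) XII `betaS_step_le_of_lose_of_child` with
`r′_h + d ≤ p` replaced by `r′_h + n ≤ p`, `n ≤ d`, and the child's `αs′ < d!` by `d·(αs′ + 1) ≤ n·d!`).  Let `s.F = x^r · G` with
`ord₀ G = d`, `p ≤ |r| + d`, chart letter `h`, new point `b` with `b_h = 0`; `L` a left-invertible STEP frame with `u₁ = e_h` whose other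
rows pass through the new point, non-empty polygon and `δ > 1` for `(G)`; `L′` the ARRIVAL frame (`u₁ = e_h` = the NEWBORN letter, of
weight `r′_h = |r| + d − p` with `p ∤ r′_h` and `r′_h + n ≤ p`).  If the next residual `G′` has `ord₀ G′ ≥ d` and, in the arrival frame, a
non-empty polygon with `d·(αs′ + 1) ≤ n·d!` ((K-Φ1)-n at the isolated child), then **`αs′ + d! = δs`** and **`βs′ ≤ βs`**.
[cite: CossartJannsenSaito2020, Lemma 12.1 (3)] [cite: CossartPiltant2008, Lemma 4.5 (2)] -/
theorem betaS_step_le_of_lose_of_child_pow {p d n : ℕ} [DecidableEq K] {s : State K} {r : Fin 4 →₀ ℕ} {G : MvPolynomial (Fin 4) K}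
    (hF : s.F = monomial r 1 * G) (hd : ordZero G = d) (hp : p ≤ r.degree + d)
    {h : Fin 4} {b : Fin 4 → K} (hbh : b h = 0)
    (hndvd : ¬ p ∣ (r.degree + d - p)) (hcritn : r.degree + d - p + n ≤ p)
    (L L' : Fin (2 + 2) → Fin 4 → K) (M M' : Fin 4 → Fin (2 + 2) → K)
    (hM : ∀ t u, ∑ i, M t i * L i u = if t = u then 1 else 0) (hM' : ∀ t u, ∑ i, M' t i * L' i u = if t = u then 1 else 0)
    (hLu1 : L (u1 2) = Pi.single h 1)
    (hnear : ∀ i, i ≠ u1 2 → ∑ t, L i t * Function.update b h 1 t = 0)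
    (hL'u1 : L' (u1 2) = Pi.single h 1) (hL' : ∀ i, i ≠ u1 2 → L' i = Function.update (L i) h 0)
    (hne : (pts (fun i => algebraMap (MvPolynomial (Fin 4) K) (OriginLocalization K 4) (∑ t, C (L i t) * X t))
      (Ideal.span {algebraMap (MvPolynomial (Fin 4) K) (OriginLocalization K 4) G}) d).Nonempty)
    (hδ : d.factorial < deltaS (fun i => algebraMap (MvPolynomial (Fin 4) K) (OriginLocalization K 4) (∑ t, C (L i t) * X t))
      (Ideal.span {algebraMap (MvPolynomial (Fin 4) K) (OriginLocalization K 4) G}) d)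
    {G' : MvPolynomial (Fin 4) K}
    (hF' : (CentreBlowup.step p Finset.univ h b s).F = monomial ((r.filter fun i => b i = 0).update h (r.degree + d - p)) 1 * G')
    (hd' : (d : ℕ∞) ≤ ordZero G')
    (hne' : (pts (fun i => algebraMap (MvPolynomial (Fin 4) K) (OriginLocalization K 4) (∑ t, C (L' i t) * X t))
      (Ideal.span {algebraMap (MvPolynomial (Fin 4) K) (OriginLocalization K 4) G'}) d).Nonempty)
    (hα' : d * (alphaS (fun i => algebraMap (MvPolynomial (Fin 4) K) (OriginLocalization K 4) (∑ t, C (L' i t) * X t))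
      (Ideal.span {algebraMap (MvPolynomial (Fin 4) K) (OriginLocalization K 4) G'}) d + 1) ≤ n * d.factorial) :
    alphaS (fun i => algebraMap (MvPolynomial (Fin 4) K) (OriginLocalization K 4) (∑ t, C (L' i t) * X t))
          (Ideal.span {algebraMap (MvPolynomial (Fin 4) K) (OriginLocalization K 4) G'}) d + d.factorial =
        deltaS (fun i => algebraMap (MvPolynomial (Fin 4) K) (OriginLocalization K 4) (∑ t, C (L i t) * X t))
          (Ideal.span {algebraMap (MvPolynomial (Fin 4) K) (OriginLocalization K 4) G}) d ∧
      betaS (fun i => algebraMap (MvPolynomial (Fin 4) K) (OriginLocalization K 4) (∑ t, C (L' i t) * X t))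
          (Ideal.span {algebraMap (MvPolynomial (Fin 4) K) (OriginLocalization K 4) G'}) d ≤
        betaS (fun i => algebraMap (MvPolynomial (Fin 4) K) (OriginLocalization K 4) (∑ t, C (L i t) * X t))
          (Ideal.span {algebraMap (MvPolynomial (Fin 4) K) (OriginLocalization K 4) G}) d := by
  set alg := algebraMap (MvPolynomial (Fin 4) K) (OriginLocalization K 4) with halg
  set c : Fin (2 + 2) → OriginLocalization K 4 := fun i => alg (∑ t, C (L i t) * X t) with hc
  set c' : Fin (2 + 2) → OriginLocalization K 4 := fun i => alg (∑ t, C (L' i t) * X t) with hc'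
  set J : Ideal (OriginLocalization K 4) := Ideal.span {alg G} with hJ
  set φ := Localization.localRingHom (Literature.AlgebraicGeometry.Resolution.originIdeal K 4)
      (Literature.AlgebraicGeometry.Resolution.originIdeal K 4)
      (((aeval fun i => (X i + C (b i) : MvPolynomial (Fin 4) K)).comp
        (coordBlowupSubst K (↑(Finset.univ : Finset (Fin 4))) h)).toRingHom)
      (comap_translate_coordBlowupSubst_originIdeal hbh) with hφ
  have hdG : (d : ℕ∞) ≤ ordZero G := hd.symm.le
  have hcu1 : c (u1 2) = alg (X h) := by simp only [hc, hLu1, sum_C_single_mul_X]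
  have hc'u1 : c' (u1 2) = alg (X h) := by simp only [hc', hL'u1, sum_C_single_mul_X]
  have hpiv : c' (u1 2) = φ (c (u1 2)) := by rw [hc'u1, hcu1, hφ, localRingHom_chart_X_self hbh]
  have hoth : ∀ i, i ≠ u1 2 → φ (c i) = φ (c (u1 2)) * c' i := by
    intro i hi
    rw [hcu1, hφ, localRingHom_chart_X_self hbh]
    change Localization.localRingHom _ _ _ _ (alg (∑ t, C (L i t) * X t)) = alg (X h) * alg (∑ t, C (L' i t) * X t)
    rw [hL' i hi, halg, localRingHom_chart_linearForm hbh (L i) (hnear i hi)]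
  have hgen : Ideal.span (Set.range c) = maximalIdeal _ := span_range_linearFrame_eq_maximalIdeal L M hM
  have hgen' : Ideal.span (Set.range c') = maximalIdeal _ := span_range_linearFrame_eq_maximalIdeal L' M' hM'
  have hdim := ringKrullDim_originLocalization_two_add_two (K := K)
  have hJμ : J ≤ maximalIdeal _ ^ d := span_singleton_algebraMap_le_maximalIdeal_pow hdG
  -- the abstract LOSE law (`u₁`-chart; about the colon ideal, whatever its order)
  have hαlaw := alphaS_colon_add φ hpiv hoth hgen hdim hgen' hdim hJμ hne hδ
  have hβlaw := betaS_colon_le φ hpiv hoth hgen hdim hgen' hdim hJμ hne hδ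
  have hcolon : (J.map φ).colon {φ (c (u1 2)) ^ d} =
      Ideal.span {alg (PointBlowup.translate b (CentreBlowup.chartTransform d Finset.univ h G))} := by
    rw [hcu1, hφ, localRingHom_chart_X_self hbh, hJ, halg]
    exact colon_map_span_singleton_chart hbh G hdG
  rw [hcolon] at hαlaw hβlaw
  -- the next residual `G′ = ε H₀ + R̃`, `R̃ ∈ (x_h^{p − r′_h}) ⊆ (x_h^n)`
  obtain ⟨R, hstep, hRmem⟩ := step_F_eq_monomial_mul_residual (p := p) hF hdG hp h hbh
  rw [hF', monomial_one_mul_cancel_left_iff] at hstep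
  have hr'h : ((r.filter fun i => b i = 0).update h (r.degree + d - p)) h = r.degree + d - p := by
    rw [Finsupp.coe_update, Function.update_self]
  have hR : R ∈ Ideal.span {(X h : MvPolynomial (Fin 4) K) ^ (p - (r.degree + d - p))} := by
    have := hRmem h (by rw [hr'h]; exact hndvd)
    rwa [hr'h] at this
  have hRn : R ∈ Ideal.span {(X h : MvPolynomial (Fin 4) K) ^ n} := by
    obtain ⟨q, rfl⟩ := Ideal.mem_span_singleton'.mp hR
    obtain ⟨k, hk⟩ := Nat.exists_eq_add_of_le (show n ≤ p - (r.degree + d - p) by omega)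
    rw [hk, Ideal.mem_span_singleton]
    exact Dvd.dvd.mul_left (pow_dvd_pow (X h) (Nat.le_add_right n k)) _
  have hε := constantCoeff_prod_ne_zero b (fun i => r i)
  have hG' : Ideal.span {alg G'} = Ideal.span {alg (∏ i ∈ Finset.univ.filter (fun i => b i ≠ 0), (X i + C (b i)) ^ r i) *
      alg (PointBlowup.translate b (CentreBlowup.chartTransform d Finset.univ h G)) + alg R} := by
    rw [hstep, map_add, map_mul]
  -- (T1) from the child side
  have hne'' : (pts c' (Ideal.span {alg G'}) d).Nonempty := hne'
  have hα'' : d * (alphaS c' (Ideal.span {alg G'}) d + 1) ≤ n * d.factorial := hα'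
  have hJμ' : Ideal.span {alg G'} ≤ maximalIdeal _ ^ d := span_singleton_algebraMap_le_maximalIdeal_pow hd'
  rw [hG'] at hne'' hα'' hJμ'
  have hclean := pts_nonempty_and_alphaS_betaS_eq_of_cleaning_pow_symm c' hgen' hdim
    (isUnit_algebraMap_of_constantCoeff_ne_zero hε) hJμ' hne'' hα''
    (by rw [hc'u1]; exact algebraMap_mem_span_pow_of_mem_span_pow le_rfl hRn)
  change alphaS c' (Ideal.span {alg G'}) d + d.factorial = deltaS c J d ∧ betaS c' (Ideal.span {alg G'}) d ≤ betaS c J d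
  rw [hG', hclean.2.1, hclean.2.2]
  exact ⟨hαlaw, hβlaw⟩

end PhiLine

end Summit.ResolutionOfSingularities.ResolutionOfSingularities.Theorems.PIDim4

end
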